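import Mathlib
import Summits.ValiantsHypothesis.ValiantsHypothesis.Theorems.LacunarySymmetroidMatrixDescartesMonotoneExactSplit
import Summits.ValiantsHypothesis.ValiantsHypothesis.Theorems.LacunarySymmetroidMatrixDescartesOneSidedExactPencil

/-!
# `MatrixDescartes` (stmt-ValiantsHypothesis-18050) — THE EXACT MONOTONE COUNT IN THE CRUX'S CURRENCY: a pencil
# `Σ_l X^{d_l} S_l` with a non-degenerate letter `S_{l₀}`, PSD letters above it and NSD letters below it has EXACTLY
# `ν([S_kS_{l₀}⁻¹S_l]_{upper}) + π([S_kS_{l₀}⁻¹S_l]_{lower})` positive zeros counted with multiplicity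

HONEST FRAMING.  Cell `pub-symmetroid`, seat `val-sym-mdr-p2` (gen 21); helper file `--supports` the crux
`Theses.LacunarySymmetroid.MatrixDescartes` (OPEN), NO closure claim; the pencil-currency form of `…MonotoneExact` /
`…MonotoneExactSplit` (column currency: `Z₊ = ν(C₊₊) + π(C₋₋)` with multiplicity) through the signed column form of
`…GramDualPencil` and the eigen-column / raw-column factorisations of `…GramDualRankMDR` (as in `…OneSidedExactPencil`,
the one-sided case).  An EXACT COUNT on the MONOTONE sector of the crux's own objects; nothing here bears on the crux in
its window, `stub_twoSided`, `DoorA26` / `DoorA34`, registers, or `VP ≠ VNP`.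

THE SECTOR.  Real symmetric letters `S_l`, `det S_{l₀} ≠ 0`; every other letter PSD with `d_l > d_{l₀}` (UPPER) or NSD
with `d_l < d_{l₀}` (LOWER), so `x^{−d_{l₀}}F(x)` is Loewner-increasing.  Block Gram matrices of the raw letter columns:
`𝒢ₚ = [S_k S_{l₀}⁻¹ S_l]_{k,l upper}` (index `{l // d l₀ < d l} × Fin m`), `𝒢ₙ = [S_k S_{l₀}⁻¹ S_l]_{k,l lower}`
(index `{l // d l < d l₀} × Fin m`).

* `submatrix_mul_of_vanish` — restricting a factorisation `W · M` to a sub-family of columns when `M` vanishes off the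
  corresponding sub-family of rows (bookkeeping).
* `monotone_pencil_card_posRoots_multiset_eq` — eigen-column form: the count is `ν(𝕌ₚᵀS_{l₀}⁻¹𝕌ₚ) + π(𝕌ₙᵀS_{l₀}⁻¹𝕌ₙ)`
  (`𝕌ₚ` / `𝕌ₙ` the eigen-columns of positive / negative eigenvalue; `sign_of_monotone`: on the sector these are exactly
  the eigen-columns of the upper / lower letters).
* `negIndex_posGram_eq_negIndex_upperBlockGram`, `posIndex_negGram_eq_posIndex_lowerBlockGram` — the two indices are
  INTRINSIC: `𝕌ₚ = 𝕎ₚ Mₚ`, `𝕎ₚ = 𝕌ₚ Nₚ` (the letter-block-diagonal factorisations of `…GramDualRankMDR` restrict to the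
  upper letters; likewise lower), so rectangular Sylvester both ways gives `ν(𝕌ₚᵀS_{l₀}⁻¹𝕌ₚ) = ν(𝒢ₚ)`,
  `π(𝕌ₙᵀS_{l₀}⁻¹𝕌ₙ) = π(𝒢ₙ)`.
* **`monotone_pencil_card_posRoots_multiset_eq_blockGram` (THE EXACT MONOTONE COUNT, crux currency).**  On the sector
  the positive zeros of `det(Σ_l X^{d_l}S_l)` counted WITH MULTIPLICITY number EXACTLY `ν(𝒢ₚ) + π(𝒢ₙ)` — two inertia
  computations on real matrices assembled from the letters, no eigenvectors, every size `m`, every `K`, all exponents.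
  Corollaries: `…_le_blockGram` (distinct zeros), `monotone_pencil_posRoots_eq_zero_iff` (STERILE ⟺ `ν(𝒢ₚ) = 0 ∧
  π(𝒢ₙ) = 0`), `monotone_pencil_card_posRoots_multiset_le_inertia_base` (`Z₊ ≤ ν(S_{l₀}) + π(S_{l₀}) = m` with the budget
  SPLIT: upper letters are charged against `ν(S_{l₀})`, lower letters against `π(S_{l₀})`).  The one-sided exact rung
  (`oneSided_pencil_card_posRoots_multiset_eq_negIndex_blockGram`) is the case of no lower letters; the monotone incoherence
  law (`monotone_pencil_card_posRoots_multiset_le`, `Σ_{l∉core} rank S_l`) is an upper bound of this count.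

[folklore] (Sylvester's law of inertia; spectral theorem).  Axioms `propext`, `Classical.choice`, `Quot.sound`.
No definitions.
-/

-- layout Summits/ValiantsHypothesis/ValiantsHypothesis forces the duplicated namespace component
set_option linter.dupNamespace false

namespace Summit.ValiantsHypothesis.ValiantsHypothesis.Theorems.LacunarySymmetroidMatrixDescartes

open Polynomial Matrix Finset
open scoped BigOperators

namespace GramDual

/-! ## §1  Restricting a factorisation to a sub-family of columns -/

section Restrict

variable {m : ℕ} {π τ π' τ' : Type} [Fintype π] [Fintype π'] [DecidableEq π]

/-- **Restriction of a factorisation.**  If `M p (g t) = 0` for every `p` outside the range of an injective `f`, then the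
`g`-columns of `W · M` are `(f-columns of W) · M|_{f × g}`. [folklore] -/
theorem submatrix_mul_of_vanish (W : Matrix (Fin m) π ℝ) (M : Matrix π τ ℝ) (f : π' → π)
    (hf : Function.Injective f) (g : τ' → τ) (hvanish : ∀ p t, (∀ p', f p' ≠ p) → M p (g t) = 0) :
    (W * M).submatrix id g = W.submatrix id f * M.submatrix f g := by
  classical
  ext a t
  simp only [Matrix.submatrix_apply, Matrix.mul_apply, id]
  have himage : ∑ p', W a (f p') * M (f p') (g t) = ∑ p ∈ Finset.univ.image f, W a p * M p (g t) := by
    rw [Finset.sum_image (fun p₁ _ p₂ _ h => hf h)]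
  rw [himage]
  symm
  refine Finset.sum_subset (Finset.subset_univ _) fun p _ hp => ?_
  rw [hvanish p t (fun p' h => hp (Finset.mem_image.2 ⟨p', Finset.mem_univ _, h⟩)), mul_zero]

end Restrict

section MonotonePencil

variable {K m : ℕ} (d : Fin K → ℕ) (S : Fin K → Matrix (Fin m) (Fin m) ℝ) (hS : ∀ l, (S l).IsHermitian) (l₀ : Fin K)

/-- the column type: non-zero eigen-columns of the letters `l ≠ l₀` (file-local notation, as in `…GramDualRank`) -/
local notation3 (prettyPrint := false) "𝕋" =>
  {li : Fin K × Fin m // li.1 ≠ l₀ ∧ (hS li.1).eigenvalues li.2 ≠ 0}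

/-- the eigen-column matrix (file-local notation, as in `…GramDualRank`) -/
local notation3 (prettyPrint := false) "𝕌" =>
  (Matrix.of fun (a : Fin m) (t : 𝕋) => ((hS t.1.1).eigenvectorUnitary : Matrix (Fin m) (Fin m) ℝ) a t.1.2)

/-- the positive eigen-columns (file-local notation) -/
local notation3 (prettyPrint := false) "𝕌ₚ" =>
  (Matrix.of fun (a : Fin m) (t : {t : 𝕋 // 0 < (hS t.1.1).eigenvalues t.1.2}) => (𝕌) a t.1)

/-- the non-positive (= negative) eigen-columns (file-local notation) -/
local notation3 (prettyPrint := false) "𝕌ₙ" =>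
  (Matrix.of fun (a : Fin m) (t : {t : 𝕋 // ¬ 0 < (hS t.1.1).eigenvalues t.1.2}) => (𝕌) a t.1)

/-- the raw column matrix of the letters `l ≠ l₀` (file-local notation, as in `…GramDualRankMDR`) -/
local notation3 (prettyPrint := false) "𝕎" =>
  (Matrix.of fun (a : Fin m) (p : {l : Fin K // l ≠ l₀} × Fin m) => S p.1.1 a p.2)

/-- the raw columns of the UPPER letters `d_l > d_{l₀}` (file-local notation) -/
local notation3 (prettyPrint := false) "𝕎ₚ" =>
  (Matrix.of fun (a : Fin m) (p : {l : Fin K // d l₀ < d l} × Fin m) => S p.1.1 a p.2)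

/-- the raw columns of the LOWER letters `d_l < d_{l₀}` (file-local notation) -/
local notation3 (prettyPrint := false) "𝕎ₙ" =>
  (Matrix.of fun (a : Fin m) (p : {l : Fin K // d l < d l₀} × Fin m) => S p.1.1 a p.2)

/-! ## §2  The exact count in eigen-column form -/

include hS in
/-- The upper block Gram matrix `[S_k S_{l₀}⁻¹ S_l]_{d_k, d_l > d_{l₀}}` is hermitian. [folklore] -/
theorem isHermitian_upperBlockGram : ((𝕎ₚ)ᵀ * (S l₀)⁻¹ * 𝕎ₚ).IsHermitian :=
  isHermitian_gram (isSymm_of_isHermitian_real (hS l₀)) _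

include hS in
/-- The lower block Gram matrix `[S_k S_{l₀}⁻¹ S_l]_{d_k, d_l < d_{l₀}}` is hermitian. [folklore] -/
theorem isHermitian_lowerBlockGram : ((𝕎ₙ)ᵀ * (S l₀)⁻¹ * 𝕎ₙ).IsHermitian :=
  isHermitian_gram (isSymm_of_isHermitian_real (hS l₀)) _

/-- The Gram matrix of the positive eigen-columns is hermitian. [folklore] -/
theorem isHermitian_posGram : ((𝕌ₚ)ᵀ * (S l₀)⁻¹ * 𝕌ₚ).IsHermitian :=
  isHermitian_gram (isSymm_of_isHermitian_real (hS l₀)) _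

/-- The Gram matrix of the non-positive eigen-columns is hermitian. [folklore] -/
theorem isHermitian_negGram : ((𝕌ₙ)ᵀ * (S l₀)⁻¹ * 𝕌ₙ).IsHermitian :=
  isHermitian_gram (isSymm_of_isHermitian_real (hS l₀)) _

/-- On the monotone sector the signs and exponents of the eigen-columns are coupled: `λ > 0 ∧ d > d_{l₀} ∧ PSD` or
`λ < 0 ∧ d < d_{l₀} ∧ NSD`. [folklore] -/
theorem sign_of_monotone
    (hmono : ∀ l, l ≠ l₀ → ((S l).PosSemidef ∧ d l₀ < d l) ∨ ((-(S l)).PosSemidef ∧ d l < d l₀)) (t : 𝕋) :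
    (0 < (hS t.1.1).eigenvalues t.1.2 ∧ d l₀ < d t.1.1 ∧ (S t.1.1).PosSemidef)
      ∨ ((hS t.1.1).eigenvalues t.1.2 < 0 ∧ d t.1.1 < d l₀ ∧ (-(S t.1.1)).PosSemidef) := by
  rcases hmono t.1.1 t.2.1 with ⟨hpsd, hd⟩ | ⟨hnsd, hd⟩
  · exact Or.inl ⟨lt_of_le_of_ne (eigenvalues_nonneg_of_posSemidef' (hS t.1.1) hpsd t.1.2) (Ne.symm t.2.2), hd, hpsd⟩
  · exact Or.inr ⟨lt_of_le_of_ne (eigenvalues_nonpos_of_neg_posSemidef (hS t.1.1) hnsd t.1.2) t.2.2, hd, hnsd⟩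

/-- **THE EXACT MONOTONE COUNT (crux currency, eigen-column form).**  Real symmetric letters, `det S_{l₀} ≠ 0`, every
other letter PSD with `d_l > d_{l₀}` or NSD with `d_l < d_{l₀}`: the positive zeros of `det(Σ_l X^{d_l}S_l)` counted
with multiplicity number exactly `ν(𝕌ₚᵀS_{l₀}⁻¹𝕌ₚ) + π(𝕌ₙᵀS_{l₀}⁻¹𝕌ₙ)` (Gram matrices of the positive / negative
eigen-columns). [folklore] -/
theorem monotone_pencil_card_posRoots_multiset_eq (hS₀ : IsUnit (S l₀).det)
    (hmono : ∀ l, l ≠ l₀ → ((S l).PosSemidef ∧ d l₀ < d l) ∨ ((-(S l)).PosSemidef ∧ d l < d l₀)) :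
    Multiset.card ((Matrix.det (∑ l, ((Polynomial.X : Polynomial ℝ) ^ d l) • (S l).map Polynomial.C)).roots.filter
        (fun t => 0 < t))
      = Fintype.card {j // (isHermitian_posGram S hS l₀).eigenvalues j < 0}
        + Fintype.card {j // 0 < (isHermitian_negGram S hS l₀).eigenvalues j} := by
  classical
  rw [pencil_eq_base_add_signedPart d S hS l₀]
  refine card_posRoots_multiset_eq_of_monotone_split (S l₀) (isSymm_of_isHermitian_real (hS l₀)) hS₀ (𝕌)
    (fun t : 𝕋 => (hS t.1.1).eigenvalues t.1.2) (d l₀) (fun t : 𝕋 => d t.1.1) (fun t => ?_)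
    (isHermitian_posGram S hS l₀) (isHermitian_negGram S hS l₀)
  rcases sign_of_monotone d S hS l₀ hmono t with ⟨h1, h2, -⟩ | ⟨h1, h2, -⟩
  · exact Or.inl ⟨h1, h2⟩
  · exact Or.inr ⟨h1, h2⟩

/-! ## §3  The indices are intrinsic: eigen-column Gram blocks vs raw block Gram matrices -/

/-- **`ν(𝕌ₚᵀS_{l₀}⁻¹𝕌ₚ) = ν([S_kS_{l₀}⁻¹S_l]_{d_k,d_l > d_{l₀}})`** on the monotone sector. [folklore] -/
theorem negIndex_posGram_eq_negIndex_upperBlockGram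
    (hmono : ∀ l, l ≠ l₀ → ((S l).PosSemidef ∧ d l₀ < d l) ∨ ((-(S l)).PosSemidef ∧ d l < d l₀)) :
    Fintype.card {j // (isHermitian_posGram S hS l₀).eigenvalues j < 0}
      = Fintype.card {j // (isHermitian_upperBlockGram d S hS l₀).eigenvalues j < 0} := by
  classical
  -- the re-indexing of the upper raw columns inside all raw columns
  have hne : ∀ l : {l : Fin K // d l₀ < d l}, l.1 ≠ l₀ := fun l h => by have := l.2; rw [h] at this; exact lt_irrefl _ this
  set f : {l : Fin K // d l₀ < d l} × Fin m → {l : Fin K // l ≠ l₀} × Fin m := fun p => (⟨p.1.1, hne p.1⟩, p.2) with hf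
  have hfinj : Function.Injective f := by
    intro p q h
    simp only [hf, Prod.mk.injEq, Subtype.mk.injEq] at h
    exact Prod.ext (Subtype.ext h.1) h.2
  have hWf : (𝕎).submatrix id f = 𝕎ₚ := by
    ext a p; rfl
  -- upper eigen-columns: positive eigenvalue ⇒ upper letter
  have hup : ∀ t : {t : 𝕋 // 0 < (hS t.1.1).eigenvalues t.1.2}, d l₀ < d t.1.1.1 := fun t => by
    rcases sign_of_monotone d S hS l₀ hmono t.1 with ⟨-, h, -⟩ | ⟨h, -, -⟩
    · exact h
    · exact absurd t.2 (not_lt.2 h.le)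
  -- the factorisation matrices of `…GramDualRankMDR`
  set M := Matrix.of (fun (p : {l : Fin K // l ≠ l₀} × Fin m) (t : 𝕋) =>
    if p.1.1 = t.1.1 then ⇑((hS t.1.1).eigenvectorBasis t.1.2) p.2 / (hS t.1.1).eigenvalues t.1.2 else 0) with hM
  set N := Matrix.of (fun (t : 𝕋) (p : {l : Fin K // l ≠ l₀} × Fin m) =>
    if t.1.1 = p.1.1 then (hS t.1.1).eigenvalues t.1.2 * ⇑((hS t.1.1).eigenvectorBasis t.1.2) p.2 else 0) with hN
  have hUfac : (𝕌ₚ) = 𝕎ₚ * M.submatrix f (fun t : {t : 𝕋 // 0 < (hS t.1.1).eigenvalues t.1.2} => t.1) := by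
    have h := submatrix_mul_of_vanish (𝕎) M f hfinj
      (fun t : {t : 𝕋 // 0 < (hS t.1.1).eigenvalues t.1.2} => t.1) (fun p t hp => by
        simp only [hM, Matrix.of_apply]
        rw [if_neg]
        intro hpt
        have hdp : d l₀ < d p.1.1 := by rw [hpt]; exact hup t
        exact hp (⟨p.1.1, hdp⟩, p.2) (Prod.ext (Subtype.ext rfl) rfl))
    rw [← eigenCols_eq_blockCols_mul S hS l₀, hWf] at h
    rw [← h]
    ext a t; rfl
  have hWfac : (𝕎ₚ) = 𝕌ₚ * N.submatrix (fun t : {t : 𝕋 // 0 < (hS t.1.1).eigenvalues t.1.2} => t.1) f := by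
    have h := submatrix_mul_of_vanish (𝕌) N (fun t : {t : 𝕋 // 0 < (hS t.1.1).eigenvalues t.1.2} => t.1)
      Subtype.val_injective f (fun t p ht => by
        simp only [hN, Matrix.of_apply]
        rw [if_neg]
        intro htp
        have hpos : 0 < (hS t.1.1).eigenvalues t.1.2 := by
          rcases sign_of_monotone d S hS l₀ hmono t with ⟨h, -, -⟩ | ⟨-, h, -⟩
          · exact h
          · exact absurd (lt_trans h (htp ▸ p.1.2 : d l₀ < d t.1.1)) (lt_irrefl _)
        exact ht ⟨t, hpos⟩ rfl)
    rw [← blockCols_eq_eigenCols_mul S hS l₀, hWf] at h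
    have hsub : (𝕌).submatrix id (fun t : {t : 𝕋 // 0 < (hS t.1.1).eigenvalues t.1.2} => t.1) = 𝕌ₚ := by
      ext a t; rfl
    rw [hsub] at h
    exact h
  apply le_antisymm
  · set M' := M.submatrix f (fun t : {t : 𝕋 // 0 < (hS t.1.1).eigenvalues t.1.2} => t.1) with hM'
    have hG : (𝕌ₚ)ᵀ * (S l₀)⁻¹ * 𝕌ₚ = M'ᵀ * ((𝕎ₚ)ᵀ * (S l₀)⁻¹ * 𝕎ₚ) * M' := by
      rw [hUfac, Matrix.transpose_mul]
      simp only [Matrix.mul_assoc]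
    have hGH : (M'ᵀ * ((𝕎ₚ)ᵀ * (S l₀)⁻¹ * 𝕎ₚ) * M').IsHermitian := by rw [← hG]; exact isHermitian_posGram S hS l₀
    rw [Inertia.negIndex_congr (isHermitian_posGram S hS l₀) hGH hG]
    exact negIndex_conj_le (isHermitian_upperBlockGram d S hS l₀) M' hGH
  · set N' := N.submatrix (fun t : {t : 𝕋 // 0 < (hS t.1.1).eigenvalues t.1.2} => t.1) f with hN'
    have hG : (𝕎ₚ)ᵀ * (S l₀)⁻¹ * 𝕎ₚ = N'ᵀ * ((𝕌ₚ)ᵀ * (S l₀)⁻¹ * 𝕌ₚ) * N' := by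
      rw [hWfac, Matrix.transpose_mul]
      simp only [Matrix.mul_assoc]
    have hGH : (N'ᵀ * ((𝕌ₚ)ᵀ * (S l₀)⁻¹ * 𝕌ₚ) * N').IsHermitian := by
      rw [← hG]; exact isHermitian_upperBlockGram d S hS l₀
    rw [Inertia.negIndex_congr (isHermitian_upperBlockGram d S hS l₀) hGH hG]
    exact negIndex_conj_le (isHermitian_posGram S hS l₀) N' hGH

/-- **`π(𝕌ₙᵀS_{l₀}⁻¹𝕌ₙ) = π([S_kS_{l₀}⁻¹S_l]_{d_k,d_l < d_{l₀}})`** on the monotone sector. [folklore] -/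
theorem posIndex_negGram_eq_posIndex_lowerBlockGram
    (hmono : ∀ l, l ≠ l₀ → ((S l).PosSemidef ∧ d l₀ < d l) ∨ ((-(S l)).PosSemidef ∧ d l < d l₀)) :
    Fintype.card {j // 0 < (isHermitian_negGram S hS l₀).eigenvalues j}
      = Fintype.card {j // 0 < (isHermitian_lowerBlockGram d S hS l₀).eigenvalues j} := by
  classical
  have hne : ∀ l : {l : Fin K // d l < d l₀}, l.1 ≠ l₀ := fun l h => by have := l.2; rw [h] at this; exact lt_irrefl _ this
  set f : {l : Fin K // d l < d l₀} × Fin m → {l : Fin K // l ≠ l₀} × Fin m := fun p => (⟨p.1.1, hne p.1⟩, p.2) with hf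
  have hfinj : Function.Injective f := by
    intro p q h
    simp only [hf, Prod.mk.injEq, Subtype.mk.injEq] at h
    exact Prod.ext (Subtype.ext h.1) h.2
  have hWf : (𝕎).submatrix id f = 𝕎ₙ := by
    ext a p; rfl
  -- non-positive eigen-columns: negative eigenvalue ⇒ lower letter
  have hlow : ∀ t : {t : 𝕋 // ¬ 0 < (hS t.1.1).eigenvalues t.1.2}, d t.1.1.1 < d l₀ := fun t => by
    rcases sign_of_monotone d S hS l₀ hmono t.1 with ⟨h, -, -⟩ | ⟨-, h, -⟩
    · exact absurd h t.2
    · exact h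
  set M := Matrix.of (fun (p : {l : Fin K // l ≠ l₀} × Fin m) (t : 𝕋) =>
    if p.1.1 = t.1.1 then ⇑((hS t.1.1).eigenvectorBasis t.1.2) p.2 / (hS t.1.1).eigenvalues t.1.2 else 0) with hM
  set N := Matrix.of (fun (t : 𝕋) (p : {l : Fin K // l ≠ l₀} × Fin m) =>
    if t.1.1 = p.1.1 then (hS t.1.1).eigenvalues t.1.2 * ⇑((hS t.1.1).eigenvectorBasis t.1.2) p.2 else 0) with hN
  have hUfac : (𝕌ₙ) = 𝕎ₙ * M.submatrix f (fun t : {t : 𝕋 // ¬ 0 < (hS t.1.1).eigenvalues t.1.2} => t.1) := by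
    have h := submatrix_mul_of_vanish (𝕎) M f hfinj
      (fun t : {t : 𝕋 // ¬ 0 < (hS t.1.1).eigenvalues t.1.2} => t.1) (fun p t hp => by
        simp only [hM, Matrix.of_apply]
        rw [if_neg]
        intro hpt
        have hdp : d p.1.1 < d l₀ := by rw [hpt]; exact hlow t
        exact hp (⟨p.1.1, hdp⟩, p.2) (Prod.ext (Subtype.ext rfl) rfl))
    rw [← eigenCols_eq_blockCols_mul S hS l₀, hWf] at h
    rw [← h]
    ext a t; rfl
  have hWfac : (𝕎ₙ) = 𝕌ₙ * N.submatrix (fun t : {t : 𝕋 // ¬ 0 < (hS t.1.1).eigenvalues t.1.2} => t.1) f := by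
    have h := submatrix_mul_of_vanish (𝕌) N (fun t : {t : 𝕋 // ¬ 0 < (hS t.1.1).eigenvalues t.1.2} => t.1)
      Subtype.val_injective f (fun t p ht => by
        simp only [hN, Matrix.of_apply]
        rw [if_neg]
        intro htp
        have hnp : ¬ 0 < (hS t.1.1).eigenvalues t.1.2 := by
          rcases sign_of_monotone d S hS l₀ hmono t with ⟨-, h, -⟩ | ⟨h, -, -⟩
          · exact absurd (lt_trans h (htp ▸ p.1.2 : d t.1.1 < d l₀)) (lt_irrefl _)
          · exact not_lt.2 h.le
        exact ht ⟨t, hnp⟩ rfl)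
    rw [← blockCols_eq_eigenCols_mul S hS l₀, hWf] at h
    have hsub : (𝕌).submatrix id (fun t : {t : 𝕋 // ¬ 0 < (hS t.1.1).eigenvalues t.1.2} => t.1) = 𝕌ₙ := by
      ext a t; rfl
    rw [hsub] at h
    exact h
  apply le_antisymm
  · set M' := M.submatrix f (fun t : {t : 𝕋 // ¬ 0 < (hS t.1.1).eigenvalues t.1.2} => t.1) with hM'
    have hG : (𝕌ₙ)ᵀ * (S l₀)⁻¹ * 𝕌ₙ = M'ᵀ * ((𝕎ₙ)ᵀ * (S l₀)⁻¹ * 𝕎ₙ) * M' := by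
      rw [hUfac, Matrix.transpose_mul]
      simp only [Matrix.mul_assoc]
    have hGH : (M'ᵀ * ((𝕎ₙ)ᵀ * (S l₀)⁻¹ * 𝕎ₙ) * M').IsHermitian := by rw [← hG]; exact isHermitian_negGram S hS l₀
    rw [Inertia.posIndex_congr (isHermitian_negGram S hS l₀) hGH hG]
    exact posIndex_conj_le (isHermitian_lowerBlockGram d S hS l₀) M' hGH
  · set N' := N.submatrix (fun t : {t : 𝕋 // ¬ 0 < (hS t.1.1).eigenvalues t.1.2} => t.1) f with hN'
    have hG : (𝕎ₙ)ᵀ * (S l₀)⁻¹ * 𝕎ₙ = N'ᵀ * ((𝕌ₙ)ᵀ * (S l₀)⁻¹ * 𝕌ₙ) * N' := by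
      rw [hWfac, Matrix.transpose_mul]
      simp only [Matrix.mul_assoc]
    have hGH : (N'ᵀ * ((𝕌ₙ)ᵀ * (S l₀)⁻¹ * 𝕌ₙ) * N').IsHermitian := by
      rw [← hG]; exact isHermitian_lowerBlockGram d S hS l₀
    rw [Inertia.posIndex_congr (isHermitian_lowerBlockGram d S hS l₀) hGH hG]
    exact posIndex_conj_le (isHermitian_negGram S hS l₀) N' hGH

/-! ## §4  THE EXACT MONOTONE COUNT IN THE CRUX'S CURRENCY -/

/-- **THE EXACT MONOTONE COUNT (crux currency, block form).**  Real symmetric letters `S_l`, `det S_{l₀} ≠ 0`, every other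
letter PSD with exponent `d_l > d_{l₀}` or NSD with `d_l < d_{l₀}`.  Then the positive zeros of `det(Σ_l X^{d_l} S_l)`
counted WITH MULTIPLICITY number EXACTLY
`ν([S_k S_{l₀}⁻¹ S_l]_{d_k, d_l > d_{l₀}}) + π([S_k S_{l₀}⁻¹ S_l]_{d_k, d_l < d_{l₀}})`
— two inertia computations on real matrices built from the letters, no eigenvectors, every size, all exponents. [folklore] -/
theorem monotone_pencil_card_posRoots_multiset_eq_blockGram (hS₀ : IsUnit (S l₀).det)
    (hmono : ∀ l, l ≠ l₀ → ((S l).PosSemidef ∧ d l₀ < d l) ∨ ((-(S l)).PosSemidef ∧ d l < d l₀)) :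
    Multiset.card ((Matrix.det (∑ l, ((Polynomial.X : Polynomial ℝ) ^ d l) • (S l).map Polynomial.C)).roots.filter
        (fun t => 0 < t))
      = Fintype.card {j // (isHermitian_upperBlockGram d S hS l₀).eigenvalues j < 0}
        + Fintype.card {j // 0 < (isHermitian_lowerBlockGram d S hS l₀).eigenvalues j} := by
  rw [monotone_pencil_card_posRoots_multiset_eq d S hS l₀ hS₀ hmono, negIndex_posGram_eq_negIndex_upperBlockGram d S hS l₀ hmono,
    posIndex_negGram_eq_posIndex_lowerBlockGram d S hS l₀ hmono]

/-- **Distinct zeros**: `Z₊ ≤ ν([S_kS_{l₀}⁻¹S_l]_{upper}) + π([S_kS_{l₀}⁻¹S_l]_{lower})` on the monotone sector. [folklore] -/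
theorem monotone_pencil_card_posRoots_le_blockGram (hS₀ : IsUnit (S l₀).det)
    (hmono : ∀ l, l ≠ l₀ → ((S l).PosSemidef ∧ d l₀ < d l) ∨ ((-(S l)).PosSemidef ∧ d l < d l₀)) :
    ((Matrix.det (∑ l, ((Polynomial.X : Polynomial ℝ) ^ d l) • (S l).map Polynomial.C)).roots.toFinset.filter
        (fun t => 0 < t)).card
      ≤ Fintype.card {j // (isHermitian_upperBlockGram d S hS l₀).eigenvalues j < 0}
        + Fintype.card {j // 0 < (isHermitian_lowerBlockGram d S hS l₀).eigenvalues j} := by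
  classical
  rw [← monotone_pencil_card_posRoots_multiset_eq_blockGram d S hS l₀ hS₀ hmono, ← Multiset.toFinset_filter]
  exact Multiset.toFinset_card_le _

/-- **STERILE ⟺ COHERENT (crux currency).**  On the monotone sector the pencil has no positive zero iff
`[S_kS_{l₀}⁻¹S_l]_{upper}` has no negative eigenvalue and `[S_kS_{l₀}⁻¹S_l]_{lower}` has no positive eigenvalue.
[folklore] -/
theorem monotone_pencil_posRoots_eq_zero_iff (hS₀ : IsUnit (S l₀).det)
    (hmono : ∀ l, l ≠ l₀ → ((S l).PosSemidef ∧ d l₀ < d l) ∨ ((-(S l)).PosSemidef ∧ d l < d l₀)) :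
    (Matrix.det (∑ l, ((Polynomial.X : Polynomial ℝ) ^ d l) • (S l).map Polynomial.C)).roots.filter (fun t => 0 < t) = 0
      ↔ Fintype.card {j // (isHermitian_upperBlockGram d S hS l₀).eigenvalues j < 0} = 0
        ∧ Fintype.card {j // 0 < (isHermitian_lowerBlockGram d S hS l₀).eigenvalues j} = 0 := by
  rw [← Multiset.card_eq_zero, monotone_pencil_card_posRoots_multiset_eq_blockGram d S hS l₀ hS₀ hmono]
  omega

/-- **`Z₊ ≤ ν(S_{l₀}) + π(S_{l₀}) = m` with multiplicity** on the monotone sector (each Gram index is at most the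
corresponding index of the base) — the two-sided rung with the SPLIT budget `ν(S_{l₀})` for the upper letters and
`π(S_{l₀})` for the lower ones. [folklore] -/
theorem monotone_pencil_card_posRoots_multiset_le_inertia_base (hS₀ : IsUnit (S l₀).det)
    (hmono : ∀ l, l ≠ l₀ → ((S l).PosSemidef ∧ d l₀ < d l) ∨ ((-(S l)).PosSemidef ∧ d l < d l₀)) :
    Multiset.card ((Matrix.det (∑ l, ((Polynomial.X : Polynomial ℝ) ^ d l) • (S l).map Polynomial.C)).roots.filter
        (fun t => 0 < t))
      ≤ Fintype.card {j // (hS l₀).eigenvalues j < 0} + Fintype.card {j // 0 < (hS l₀).eigenvalues j} := by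
  rw [monotone_pencil_card_posRoots_multiset_eq d S hS l₀ hS₀ hmono]
  exact Nat.add_le_add
    (negIndex_gram_le (isSymm_of_isHermitian_real (hS l₀)) hS₀ (hS l₀) _ (isHermitian_posGram S hS l₀))
    (posIndex_gram_le (isSymm_of_isHermitian_real (hS l₀)) hS₀ (hS l₀) _ (isHermitian_negGram S hS l₀))

end MonotonePencil

end GramDual

end Summit.ValiantsHypothesis.ValiantsHypothesis.Theorems.LacunarySymmetroidMatrixDescartes
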